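/-
Copyright: the b2b-balaban T⁴-continuum CRUX team, row NE7b OWNER lineage `t4-ne7b-p1` (gen 128). Project licence.
-/
import Summits.QuantumFields.BalabanUV.T4Continuum.Spine.NE7b.SupActivityPolymerGas
import Summits.QuantumFields.BalabanUV.T4Continuum.Spine.NE7b.SupGaussianRegulator
import Summits.QuantumFields.BalabanUV.T4Continuum.Spine.NE7b.SupGaussianFiniteRangeDependence

/-!
# REGULATED CELL FACTORS OVER A FINITE-RANGE GAUSSIAN FIELD FORM A CONVERGENT POLYMER GAS, UNIFORMLY IN THE VOLUME: if
# `‖g_p(ω)‖ ≤ ε·e^{½κΣ_{x∈cell p} ω_x²}` (NO sup bound), the cells are disjoint blocks of `≤ v` sites, `Γ ⪯ γ_op·1` has diagonal `≤ γ` and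
# range `ρ`, and `κγ_op ≤ θ < 1`, then the activities obey `‖E_{N(0,Γ)} ∏_{p∈K} g_p‖ ≤ ε′^{#K}` with `ε′ = ε·A^v`, `A = (1−θ)^{−κγ∕(2θ)}`,
# so under `e ε′(Δ+1)² ≤ 1∕2`: `Z(C) = ∫∏_{p∈C}(1+g_p) dN(0,Γ)` is the partition function of a hard-core polymer gas, zero-free, with
# exclusion costs `e^{∓#D(Δ+1)2eε′}` and `‖log Z(C)‖ ≤ #C(Δ+1)2eε′` — the answer to `g127/records/SCOPING-d2.md` without characteristic
# functions and without a new normed polymer-gas module (row NE7b, node U5c; (287) + (288) + (276) BY NAME; [folklore])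

Cell `pub-balaban`, sub-cell `t4`, spine estimate NE7b (`T4WeightBudget.RelWeightBound`; the cell's OWN estimate — NOT PRINTED in
[Bałaban 1983–89], NOT PROVED).  Crux-route work under `Spine/NE7b/` by the row OWNER (`t4-ne7b-p1` gen 128, file (289)) under FREEZE
(0)'s crux-prover clause, on § [NE7bP1-G127-HANDOFF] NEXT (3)(b); NOTHING of Bałaban's is named as a Lean object, valued or asserted; no
`T4Continuum/Support` leaf typed; no `def`, no notation; zero `sorry`.  Imports (BY NAME): the OWNER's (287) `…SupActivityPolymerGas`
(`act_measurable_prod`, `act_pertZ_eq_polymerPartitionFunction`, `act_pertZ_ne_zero`, `act_norm_pertZ_sdiff_div_le`,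
`act_exp_neg_le_norm_pertZ_sdiff_div`, `act_exp_pertLogZ`, `act_norm_pertLogZ_le`), (288) `…SupGaussianRegulator` (`integral_exp_half_sq_on_le`,
`integrable_exp_half_sq_on`), (276) `…SupGaussianFiniteRangeDependence` (`gaussian_indep_of_not_touches`); the tree's `pertZ`, `cellActivity`,
`pertLogZ`, `rconnSubsets`, `polymerPartitionFunction`, `Touches`, `GeomInc`, `IsRConnected`, `HasFiniteRange`.

WHY (located).  `g127/records/SCOPING-d2.md` located the obstruction «the tree's `IsLocalPerturbation` takes SUP-bounded factors
`‖g_p‖ ≤ ε`; the road's `e^{−v_p(ζ)} − 1` are bounded only on small fields» and offered (i) small-field characteristic functions (with a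
VOLUME-dependent large-field remainder) or (ii) a new normed polymer-gas module.  Gen 128's decision is (iii): the KP layer needs only
ACTIVITY bounds ((287)), the tree already integrates quadratic regulators exactly ((288) on `GaussianQuadraticTilt` + `DetOneSubTraceBound`),
and a regulated sup bound — which the road's factors DO satisfy by stability + cubic smallness ((290)) — gives the activity bound with
`ε′ = εA^v`.  No characteristic functions, no volume factor, no new module.

WHAT IS PROVED ([folklore]; `μ = multivariateGaussian 0 Γ` on `EuclideanSpace ℝ ι`, cell σ-algebras `𝓕_p = σ(ω|_{cell p})` as in (276)):
* §1 `norm_prod_le_regulator` (disjoint cells: `‖∏_{p∈K} g_p(ω)‖ ≤ ε^{#K}e^{½κΣ_{x∈∪_K cells}ω_x²}`), `card_biUnion_cell_le` (`#∪_K cells ≤ v#K`),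
  `one_le_regulatorCost` (`1 ≤ A`);
* §2 `measurable_prod_cells`, **`integrable_prod_of_regulated`** (products of regulated factors are `N(0,Γ)`-integrable);
* §3 **`norm_cellActivity_le_of_regulated`** (`‖M(K)‖ ≤ (εA^v)^{#K}` for EVERY finite cell set `K`; no measurability needed);
* §4 `regulated_hypotheses` (the six activity-level hypotheses of (287) hold with `ε′ = εA^v`), THE END: **`regulated_pertZ_eq_polymerPartitionFunction`**,
  **`regulated_pertZ_ne_zero`**, **`regulated_norm_pertZ_sdiff_div_le`**, **`regulated_exp_neg_le_norm_pertZ_sdiff_div`**, **`regulated_exp_pertLogZ`**,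
  **`regulated_norm_pertLogZ_le`** (`‖log Z(C)‖ ≤ #C(Δ+1)2e·εA^v`, uniformly in `C` — from the activity bound ALONE: no range, no
  measurability hypothesis); §5 toy.

HONEST (what this is NOT).  The regulated hypothesis is an INPUT here (discharged for the road's Taylor-remainder factors in (290) under
stability + cubic smallness + `κ > 2κ₀`); one Gaussian reference `N(0,Γ)` of finite range (one scale of (280)'s split — the multiscale
induction, the external-field dependence of the activities (renormalised regulator, the tree's `norm_integral_shift_le_of_norm_le_exp`) and
the large-field REGIONS of Bałaban's `R`-operation are not typed); scalar skeleton ((A3), NC-NE7b-α UNRULED); nothing of Bałaban's asserted.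
BY-NAME EFFECT ON THE WALL: NONE.  NE7b NOT PRINTED ∕ NOT PROVED; spine PROVED 0∕9; rung (B)+1 — the programme's measures remain FINITE-torus
statements; NOT the mass gap, NOT Clay.  HONEST DEPENDENCY: continuum YM on T⁴ ⇐ BetaPertH ∧ nine spine estimates (0∕9 proved); BetaPertH ⇐
(D1) ∧ (D4) ∧ CAP+tail; G-an2-4 gates asym, D1 and NE2∕3∕4.
-/

set_option autoImplicit false

noncomputable section

namespace Summit.QuantumFields.BalabanUV.T4Continuum.NE7b.SupRegulatedActivityBound

open MeasureTheory ProbabilityTheory Finset Real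
open scoped BigOperators
open Literature.Probability.LatticeModels (Touches GeomInc IsRConnected pertZ cellActivity pertLogZ rconnSubsets
  polymerPartitionFunction)
open Literature.Analysis.Matrix (HasFiniteRange)
open SupActivityPolymerGas SupGaussianRegulator SupGaussianFiniteRangeDependence

variable {ι : Type} [Fintype ι] [DecidableEq ι] {V : Type*}

/-! ## §1. Pointwise: products of regulated factors are regulated on the union of their cells -/

omit [Fintype ι] in
/-- **PRODUCTS OF REGULATED FACTORS ARE REGULATED**: for pairwise disjoint cells and `‖g_p(ω)‖ ≤ ε·e^{½κΣ_{x∈cell p}ω_x²}` (`ε ≥ 0`),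
`‖∏_{p∈K} g_p(ω)‖ ≤ ε^{#K}·e^{½κΣ_{x∈⋃_{p∈K} cell p} ω_x²}`. [folklore] -/
theorem norm_prod_le_regulator [DecidableEq V] (cell : V → Finset ι) (hdisj : ∀ p q, p ≠ q → Disjoint (cell p) (cell q))
    {g : V → EuclideanSpace ℝ ι → ℂ} {ε κ : ℝ} (hreg : ∀ p ω, ‖g p ω‖ ≤ ε * exp (κ * (∑ x ∈ cell p, ω x ^ 2) / 2))
    (K : Finset V) (ω : EuclideanSpace ℝ ι) :
    ‖∏ p ∈ K, g p ω‖ ≤ ε ^ K.card * exp (κ * (∑ x ∈ K.biUnion cell, ω x ^ 2) / 2) := by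
  have hpd : (K : Set V).PairwiseDisjoint cell := fun p _ q _ hpq => hdisj p q hpq
  rw [norm_prod]
  calc ∏ p ∈ K, ‖g p ω‖ ≤ ∏ p ∈ K, (ε * exp (κ * (∑ x ∈ cell p, ω x ^ 2) / 2)) :=
        prod_le_prod (fun p _ => norm_nonneg _) fun p _ => hreg p ω
    _ = ε ^ K.card * exp (κ * (∑ x ∈ K.biUnion cell, ω x ^ 2) / 2) := by
        rw [prod_mul_distrib, prod_const, ← Real.exp_sum, sum_biUnion hpd, mul_sum, sum_div]

omit [Fintype ι] in
/-- `#(⋃_{p∈K} cell p) ≤ v·#K` when every cell has `≤ v` sites. [folklore] -/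
theorem card_biUnion_cell_le [DecidableEq V] (cell : V → Finset ι) {v : ℕ} (hv : ∀ p, (cell p).card ≤ v) (K : Finset V) :
    (K.biUnion cell).card ≤ v * K.card := by
  calc (K.biUnion cell).card ≤ ∑ p ∈ K, (cell p).card := card_biUnion_le
    _ ≤ K.card • v := sum_le_card_nsmul _ _ _ fun p _ => hv p
    _ = v * K.card := by rw [smul_eq_mul, mul_comm]

/-- The regulator cost per site `A = (1−θ)^{−κγ∕(2θ)}` is `≥ 1` (`0 < θ < 1`, `κγ ≥ 0`). [folklore] -/
theorem one_le_regulatorCost {κ γ θ : ℝ} (hκγ : 0 ≤ κ * γ) (hθ0 : 0 < θ) (hθ1 : θ < 1) :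
    1 ≤ (1 - θ) ^ (-(κ * γ / (2 * θ))) :=
  Real.one_le_rpow_of_pos_of_le_one_of_nonpos (by linarith) (by linarith)
    (neg_nonpos.2 (div_nonneg hκγ (by linarith)))

/-! ## §2. Measurability and integrability of the products -/

omit [Fintype ι] [DecidableEq ι] in
/-- Products of cell-measurable factors are measurable. [folklore] -/
theorem measurable_prod_cells (cell : V → Finset ι) {g : V → EuclideanSpace ℝ ι → ℂ}
    (hmeas : ∀ p, Measurable[MeasurableSpace.comap (fun (ω : EuclideanSpace ℝ ι) (x : cell p) => ω x) inferInstance] (g p))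
    (K : Finset V) : Measurable fun ω => ∏ p ∈ K, g p ω :=
  act_measurable_prod (𝓕 := fun p => MeasurableSpace.comap (fun (ω : EuclideanSpace ℝ ι) (x : cell p) => ω x) inferInstance)
    (fun _ => measurable_iff_comap_le.1 (by fun_prop)) hmeas K

/-- **PRODUCTS OF REGULATED FACTORS ARE INTEGRABLE** against `N(0,Γ)` (`Γ ⪰ 0`, `Γ ⪯ γ_op·1`, `0 ≤ κ`, `κγ_op ≤ θ < 1`): domination by
`ε^{#K}` times the integrable regulator of (288). [folklore] -/
theorem integrable_prod_of_regulated [DecidableEq V] {Γ : Matrix ι ι ℝ} {γop : ℝ} (hΓ : Γ.PosSemidef)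
    (hΓop : (γop • (1 : Matrix ι ι ℝ) - Γ).PosSemidef) (cell : V → Finset ι) (hdisj : ∀ p q, p ≠ q → Disjoint (cell p) (cell q))
    {g : V → EuclideanSpace ℝ ι → ℂ} {ε κ θ : ℝ} (hκ : 0 ≤ κ) (hθ1 : θ < 1) (hκθ : κ * γop ≤ θ)
    (hmeas : ∀ p, Measurable[MeasurableSpace.comap (fun (ω : EuclideanSpace ℝ ι) (x : cell p) => ω x) inferInstance] (g p))
    (hreg : ∀ p ω, ‖g p ω‖ ≤ ε * exp (κ * (∑ x ∈ cell p, ω x ^ 2) / 2)) (K : Finset V) :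
    Integrable (fun ω => ∏ p ∈ K, g p ω) (multivariateGaussian 0 Γ) :=
  Integrable.mono' ((integrable_exp_half_sq_on hΓ hΓop hκ hθ1 hκθ (K.biUnion cell)).const_mul (ε ^ K.card))
    (measurable_prod_cells cell hmeas K).aestronglyMeasurable (ae_of_all _ fun ω => norm_prod_le_regulator cell hdisj hreg K ω)

/-! ## §3. The activity bound -/

/-- **THE ACTIVITY BOUND FOR REGULATED FACTORS.**  `Γ ⪰ 0`, `Γ ⪯ γ_op·1`, `Γ(i,i) ≤ γ` for all `i`, `0 ≤ γ`; disjoint cells of `≤ v`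
sites; `‖g_p(ω)‖ ≤ ε·e^{½κΣ_{x∈cell p}ω_x²}` with `0 ≤ ε`, `0 ≤ κ`, `0 < θ < 1`, `κγ_op ≤ θ` ⟹ for EVERY finite cell set `K`:
`‖∫ ∏_{p∈K} g_p dN(0,Γ)‖ ≤ (ε·A^v)^{#K}`, `A = (1−θ)^{−κγ∕(2θ)}`. [folklore] -/
theorem norm_cellActivity_le_of_regulated [DecidableEq V] {Γ : Matrix ι ι ℝ} {γop γ : ℝ} (hΓ : Γ.PosSemidef)
    (hΓop : (γop • (1 : Matrix ι ι ℝ) - Γ).PosSemidef) (hdiag : ∀ i, Γ i i ≤ γ) (hγ : 0 ≤ γ) (cell : V → Finset ι)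
    (hdisj : ∀ p q, p ≠ q → Disjoint (cell p) (cell q)) {v : ℕ} (hv : ∀ p, (cell p).card ≤ v)
    {g : V → EuclideanSpace ℝ ι → ℂ} {ε κ θ : ℝ} (hε : 0 ≤ ε) (hκ : 0 ≤ κ) (hθ0 : 0 < θ) (hθ1 : θ < 1) (hκθ : κ * γop ≤ θ)
    (hreg : ∀ p ω, ‖g p ω‖ ≤ ε * exp (κ * (∑ x ∈ cell p, ω x ^ 2) / 2)) (K : Finset V) :
    ‖cellActivity (multivariateGaussian 0 Γ) g K‖ ≤ (ε * ((1 - θ) ^ (-(κ * γ / (2 * θ)))) ^ v) ^ K.card := by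
  set μ := multivariateGaussian 0 Γ with hμ
  set A : ℝ := (1 - θ) ^ (-(κ * γ / (2 * θ))) with hA
  have hA1 : 1 ≤ A := one_le_regulatorCost (mul_nonneg hκ hγ) hθ0 hθ1
  have hint := integrable_exp_half_sq_on hΓ hΓop hκ hθ1 hκθ (K.biUnion cell)
  have hgauss := integral_exp_half_sq_on_le hΓ hΓop hκ hθ0 hθ1 hκθ (K.biUnion cell) fun i _ => hdiag i
  unfold cellActivity
  calc ‖∫ ω, ∏ p ∈ K, g p ω ∂μ‖ ≤ ∫ ω, ‖∏ p ∈ K, g p ω‖ ∂μ := norm_integral_le_integral_norm _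
    _ ≤ ∫ ω, ε ^ K.card * exp (κ * (∑ x ∈ K.biUnion cell, ω x ^ 2) / 2) ∂μ :=
        integral_mono_of_nonneg (ae_of_all _ fun _ => norm_nonneg _) (hint.const_mul _)
          (ae_of_all _ fun ω => norm_prod_le_regulator cell hdisj hreg K ω)
    _ = ε ^ K.card * ∫ ω, exp (κ * (∑ x ∈ K.biUnion cell, ω x ^ 2) / 2) ∂μ := integral_const_mul _ _
    _ ≤ ε ^ K.card * A ^ (K.biUnion cell).card := mul_le_mul_of_nonneg_left hgauss (pow_nonneg hε _)
    _ ≤ ε ^ K.card * A ^ (v * K.card) :=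
        mul_le_mul_of_nonneg_left (pow_le_pow_right₀ hA1 (card_biUnion_cell_le cell hv K)) (pow_nonneg hε _)
    _ = (ε * A ^ v) ^ K.card := by rw [mul_pow, ← pow_mul]

/-! ## §4. THE END: the polymer gas of regulated factors, uniformly in the volume -/

/-- **THE SIX ACTIVITY-LEVEL HYPOTHESES OF (287) HOLD FOR REGULATED FACTORS OVER A FINITE-RANGE GAUSSIAN FIELD**, with `ε′ = ε·A^v`:
`Γ ⪰ 0` of range `ρ` for `dι`, `Γ ⪯ γ_op·1`, diagonal `≤ γ` (`γ ≥ 0`); disjoint cells of `≤ v` sites with an adjacency `R` covering `ρ`-closeness;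
cell-measurable factors with the regulated bound. [folklore] -/
theorem regulated_hypotheses [DecidableEq V] {Γ : Matrix ι ι ℝ} {γop γ : ℝ} (hΓ : Γ.PosSemidef)
    (hΓop : (γop • (1 : Matrix ι ι ℝ) - Γ).PosSemidef) (hdiag : ∀ i, Γ i i ≤ γ) (hγ : 0 ≤ γ) {dι : ι → ι → ℕ} {ρ : ℕ}
    (hfr : HasFiniteRange dι ρ Γ) (cell : V → Finset ι) (hdisj : ∀ p q, p ≠ q → Disjoint (cell p) (cell q)) {v : ℕ}
    (hv : ∀ p, (cell p).card ≤ v) {R : V → V → Prop}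
    (hR : ∀ (p p' : V) (x y : ι), x ∈ cell p → y ∈ cell p' → dι x y ≤ ρ → p = p' ∨ R p p')
    {g : V → EuclideanSpace ℝ ι → ℂ} {ε κ θ : ℝ} (hε : 0 ≤ ε) (hκ : 0 ≤ κ) (hθ0 : 0 < θ) (hθ1 : θ < 1) (hκθ : κ * γop ≤ θ)
    (hmeas : ∀ p, Measurable[MeasurableSpace.comap (fun (ω : EuclideanSpace ℝ ι) (x : cell p) => ω x) inferInstance] (g p))
    (hreg : ∀ p ω, ‖g p ω‖ ≤ ε * exp (κ * (∑ x ∈ cell p, ω x ^ 2) / 2)) :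
    (∀ p, MeasurableSpace.comap (fun (ω : EuclideanSpace ℝ ι) (x : cell p) => ω x) inferInstance ≤
        (inferInstance : MeasurableSpace (EuclideanSpace ℝ ι))) ∧
      (∀ K₁ K₂ : Finset V, ¬ Touches R K₁ K₂ →
        Indep (⨆ p ∈ K₁, MeasurableSpace.comap (fun (ω : EuclideanSpace ℝ ι) (x : cell p) => ω x) inferInstance)
          (⨆ p ∈ K₂, MeasurableSpace.comap (fun (ω : EuclideanSpace ℝ ι) (x : cell p) => ω x) inferInstance)
          (multivariateGaussian 0 Γ)) ∧
      (∀ p, Measurable[MeasurableSpace.comap (fun (ω : EuclideanSpace ℝ ι) (x : cell p) => ω x) inferInstance] (g p)) ∧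
      (∀ K : Finset V, Integrable (fun ω => ∏ p ∈ K, g p ω) (multivariateGaussian 0 Γ)) ∧
      (∀ K : Finset V, IsRConnected R K →
        ‖cellActivity (multivariateGaussian 0 Γ) g K‖ ≤ (ε * ((1 - θ) ^ (-(κ * γ / (2 * θ)))) ^ v) ^ K.card) ∧
      0 ≤ ε * ((1 - θ) ^ (-(κ * γ / (2 * θ)))) ^ v :=
  ⟨fun _ => measurable_iff_comap_le.1 (by fun_prop),
    fun K₁ K₂ hKK => gaussian_indep_of_not_touches hΓ 0 cell hfr hR K₁ K₂ hKK, hmeas,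
    fun K => integrable_prod_of_regulated hΓ hΓop cell hdisj hκ hθ1 hκθ hmeas hreg K,
    fun K _ => norm_cellActivity_le_of_regulated hΓ hΓop hdiag hγ cell hdisj hv hε hκ hθ0 hθ1 hκθ hreg K,
    mul_nonneg hε (pow_nonneg (zero_le_one.trans (one_le_regulatorCost (mul_nonneg hκ hγ) hθ0 hθ1)) _)⟩

/-- **THE POLYMER REPRESENTATION** of `Z(C) = ∫ ∏_{p∈C}(1 + g_p) dN(0,Γ)` for regulated factors: `Z(C) = Ξ(𝒫(C); M)` (no smallness
needed). [folklore] -/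
theorem regulated_pertZ_eq_polymerPartitionFunction [DecidableEq V] {Γ : Matrix ι ι ℝ} {γop γ : ℝ} (hΓ : Γ.PosSemidef)
    (hΓop : (γop • (1 : Matrix ι ι ℝ) - Γ).PosSemidef) (hdiag : ∀ i, Γ i i ≤ γ) (hγ : 0 ≤ γ) {dι : ι → ι → ℕ} {ρ : ℕ}
    (hfr : HasFiniteRange dι ρ Γ) (cell : V → Finset ι) (hdisj : ∀ p q, p ≠ q → Disjoint (cell p) (cell q)) {v : ℕ}
    (hv : ∀ p, (cell p).card ≤ v) {R : V → V → Prop} [DecidableRel R] (hRsymm : ∀ x y, R x y → R y x)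
    (hR : ∀ (p p' : V) (x y : ι), x ∈ cell p → y ∈ cell p' → dι x y ≤ ρ → p = p' ∨ R p p')
    {g : V → EuclideanSpace ℝ ι → ℂ} {ε κ θ : ℝ} (hε : 0 ≤ ε) (hκ : 0 ≤ κ) (hθ0 : 0 < θ) (hθ1 : θ < 1) (hκθ : κ * γop ≤ θ)
    (hmeas : ∀ p, Measurable[MeasurableSpace.comap (fun (ω : EuclideanSpace ℝ ι) (x : cell p) => ω x) inferInstance] (g p))
    (hreg : ∀ p ω, ‖g p ω‖ ≤ ε * exp (κ * (∑ x ∈ cell p, ω x ^ 2) / 2)) (C : Finset V) :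
    pertZ (multivariateGaussian 0 Γ) g C =
      polymerPartitionFunction (GeomInc R) (cellActivity (multivariateGaussian 0 Γ) g) (rconnSubsets R C) := by
  obtain ⟨hle, hindep, hm, hint, -, -⟩ :=
    regulated_hypotheses hΓ hΓop hdiag hγ hfr cell hdisj hv hR hε hκ hθ0 hθ1 hκθ hmeas hreg
  exact act_pertZ_eq_polymerPartitionFunction hRsymm hle hindep hm hint C

/-- **ZERO-FREENESS** of `Z(C)` for regulated factors, under `e·(εA^v)·(Δ+1)² ≤ 1∕2`. [folklore] -/
theorem regulated_pertZ_ne_zero [DecidableEq V] {Γ : Matrix ι ι ℝ} {γop γ : ℝ} (hΓ : Γ.PosSemidef)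
    (hΓop : (γop • (1 : Matrix ι ι ℝ) - Γ).PosSemidef) (hdiag : ∀ i, Γ i i ≤ γ) (hγ : 0 ≤ γ) {dι : ι → ι → ℕ} {ρ : ℕ}
    (hfr : HasFiniteRange dι ρ Γ) (cell : V → Finset ι) (hdisj : ∀ p q, p ≠ q → Disjoint (cell p) (cell q)) {v : ℕ}
    (hv : ∀ p, (cell p).card ≤ v) {R : V → V → Prop} [DecidableRel R] (hRsymm : ∀ x y, R x y → R y x)
    (hR : ∀ (p p' : V) (x y : ι), x ∈ cell p → y ∈ cell p' → dι x y ≤ ρ → p = p' ∨ R p p') {nbr : V → Finset V} {Δ : ℕ}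
    (hΔ : ∀ x, (nbr x).card ≤ Δ) (hnbr : ∀ x y, R x y → y ∈ nbr x)
    {g : V → EuclideanSpace ℝ ι → ℂ} {ε κ θ : ℝ} (hε : 0 ≤ ε) (hκ : 0 ≤ κ) (hθ0 : 0 < θ) (hθ1 : θ < 1) (hκθ : κ * γop ≤ θ)
    (hmeas : ∀ p, Measurable[MeasurableSpace.comap (fun (ω : EuclideanSpace ℝ ι) (x : cell p) => ω x) inferInstance] (g p))
    (hreg : ∀ p ω, ‖g p ω‖ ≤ ε * exp (κ * (∑ x ∈ cell p, ω x ^ 2) / 2))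
    (hsmall : Real.exp 1 * (ε * ((1 - θ) ^ (-(κ * γ / (2 * θ)))) ^ v) * ((Δ : ℝ) + 1) ^ 2 ≤ 1 / 2) (C : Finset V) :
    pertZ (multivariateGaussian 0 Γ) g C ≠ 0 := by
  obtain ⟨hle, hindep, hm, hint, hact, hε'⟩ :=
    regulated_hypotheses hΓ hΓop hdiag hγ hfr cell hdisj hv hR hε hκ hθ0 hθ1 hκθ hmeas hreg
  exact act_pertZ_ne_zero hRsymm hΔ hnbr hle hindep hm hint hact hε' hsmall C

/-- **VOLUME-UNIFORM EXCLUSION COST** `‖Z(C∖D)∕Z(C)‖ ≤ exp(#D(Δ+1)2e·εA^v)` for regulated factors. [folklore] -/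
theorem regulated_norm_pertZ_sdiff_div_le [DecidableEq V] {Γ : Matrix ι ι ℝ} {γop γ : ℝ} (hΓ : Γ.PosSemidef)
    (hΓop : (γop • (1 : Matrix ι ι ℝ) - Γ).PosSemidef) (hdiag : ∀ i, Γ i i ≤ γ) (hγ : 0 ≤ γ) {dι : ι → ι → ℕ} {ρ : ℕ}
    (hfr : HasFiniteRange dι ρ Γ) (cell : V → Finset ι) (hdisj : ∀ p q, p ≠ q → Disjoint (cell p) (cell q)) {v : ℕ}
    (hv : ∀ p, (cell p).card ≤ v) {R : V → V → Prop} [DecidableRel R] (hRsymm : ∀ x y, R x y → R y x)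
    (hR : ∀ (p p' : V) (x y : ι), x ∈ cell p → y ∈ cell p' → dι x y ≤ ρ → p = p' ∨ R p p') {nbr : V → Finset V} {Δ : ℕ}
    (hΔ : ∀ x, (nbr x).card ≤ Δ) (hnbr : ∀ x y, R x y → y ∈ nbr x)
    {g : V → EuclideanSpace ℝ ι → ℂ} {ε κ θ : ℝ} (hε : 0 ≤ ε) (hκ : 0 ≤ κ) (hθ0 : 0 < θ) (hθ1 : θ < 1) (hκθ : κ * γop ≤ θ)
    (hmeas : ∀ p, Measurable[MeasurableSpace.comap (fun (ω : EuclideanSpace ℝ ι) (x : cell p) => ω x) inferInstance] (g p))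
    (hreg : ∀ p ω, ‖g p ω‖ ≤ ε * exp (κ * (∑ x ∈ cell p, ω x ^ 2) / 2))
    (hsmall : Real.exp 1 * (ε * ((1 - θ) ^ (-(κ * γ / (2 * θ)))) ^ v) * ((Δ : ℝ) + 1) ^ 2 ≤ 1 / 2) (C D : Finset V) :
    ‖pertZ (multivariateGaussian 0 Γ) g (C \ D) / pertZ (multivariateGaussian 0 Γ) g C‖ ≤
      Real.exp (D.card * ((Δ : ℝ) + 1) * (2 * (Real.exp 1 * (ε * ((1 - θ) ^ (-(κ * γ / (2 * θ)))) ^ v)))) := by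
  obtain ⟨hle, hindep, hm, hint, hact, hε'⟩ :=
    regulated_hypotheses hΓ hΓop hdiag hγ hfr cell hdisj hv hR hε hκ hθ0 hθ1 hκθ hmeas hreg
  exact act_norm_pertZ_sdiff_div_le hRsymm hΔ hnbr hle hindep hm hint hact hε' hsmall C D

/-- **The lower exclusion cost** `exp(−#D(Δ+1)2e·εA^v) ≤ ‖Z(C∖D)∕Z(C)‖` for regulated factors. [folklore] -/
theorem regulated_exp_neg_le_norm_pertZ_sdiff_div [DecidableEq V] {Γ : Matrix ι ι ℝ} {γop γ : ℝ} (hΓ : Γ.PosSemidef)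
    (hΓop : (γop • (1 : Matrix ι ι ℝ) - Γ).PosSemidef) (hdiag : ∀ i, Γ i i ≤ γ) (hγ : 0 ≤ γ) {dι : ι → ι → ℕ} {ρ : ℕ}
    (hfr : HasFiniteRange dι ρ Γ) (cell : V → Finset ι) (hdisj : ∀ p q, p ≠ q → Disjoint (cell p) (cell q)) {v : ℕ}
    (hv : ∀ p, (cell p).card ≤ v) {R : V → V → Prop} [DecidableRel R] [Std.Symm R]
    (hR : ∀ (p p' : V) (x y : ι), x ∈ cell p → y ∈ cell p' → dι x y ≤ ρ → p = p' ∨ R p p') {nbr : V → Finset V} {Δ : ℕ}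
    (hΔ : ∀ x, (nbr x).card ≤ Δ) (hnbr : ∀ x y, R x y → y ∈ nbr x)
    {g : V → EuclideanSpace ℝ ι → ℂ} {ε κ θ : ℝ} (hε : 0 ≤ ε) (hκ : 0 ≤ κ) (hθ0 : 0 < θ) (hθ1 : θ < 1) (hκθ : κ * γop ≤ θ)
    (hmeas : ∀ p, Measurable[MeasurableSpace.comap (fun (ω : EuclideanSpace ℝ ι) (x : cell p) => ω x) inferInstance] (g p))
    (hreg : ∀ p ω, ‖g p ω‖ ≤ ε * exp (κ * (∑ x ∈ cell p, ω x ^ 2) / 2))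
    (hsmall : Real.exp 1 * (ε * ((1 - θ) ^ (-(κ * γ / (2 * θ)))) ^ v) * ((Δ : ℝ) + 1) ^ 2 ≤ 1 / 2) (C D : Finset V) :
    Real.exp (-(D.card * ((Δ : ℝ) + 1) * (2 * (Real.exp 1 * (ε * ((1 - θ) ^ (-(κ * γ / (2 * θ)))) ^ v))))) ≤
      ‖pertZ (multivariateGaussian 0 Γ) g (C \ D) / pertZ (multivariateGaussian 0 Γ) g C‖ := by
  obtain ⟨hle, hindep, hm, hint, hact, hε'⟩ :=
    regulated_hypotheses hΓ hΓop hdiag hγ hfr cell hdisj hv hR hε hκ hθ0 hθ1 hκθ hmeas hreg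
  exact act_exp_neg_le_norm_pertZ_sdiff_div hΔ hnbr hle hindep hm hint hact hε' hsmall C D

/-- **`exp(log Z(C)) = Z(C)`** (KP branch) for regulated factors, under `e·(εA^v)·(Δ+1)² ≤ 1∕2`. [folklore] -/
theorem regulated_exp_pertLogZ [DecidableEq V] {Γ : Matrix ι ι ℝ} {γop γ : ℝ} (hΓ : Γ.PosSemidef)
    (hΓop : (γop • (1 : Matrix ι ι ℝ) - Γ).PosSemidef) (hdiag : ∀ i, Γ i i ≤ γ) (hγ : 0 ≤ γ) {dι : ι → ι → ℕ} {ρ : ℕ}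
    (hfr : HasFiniteRange dι ρ Γ) (cell : V → Finset ι) (hdisj : ∀ p q, p ≠ q → Disjoint (cell p) (cell q)) {v : ℕ}
    (hv : ∀ p, (cell p).card ≤ v) {R : V → V → Prop} [DecidableRel R] [Std.Symm R]
    (hR : ∀ (p p' : V) (x y : ι), x ∈ cell p → y ∈ cell p' → dι x y ≤ ρ → p = p' ∨ R p p') {nbr : V → Finset V} {Δ : ℕ}
    (hΔ : ∀ x, (nbr x).card ≤ Δ) (hnbr : ∀ x y, R x y → y ∈ nbr x)
    {g : V → EuclideanSpace ℝ ι → ℂ} {ε κ θ : ℝ} (hε : 0 ≤ ε) (hκ : 0 ≤ κ) (hθ0 : 0 < θ) (hθ1 : θ < 1) (hκθ : κ * γop ≤ θ)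
    (hmeas : ∀ p, Measurable[MeasurableSpace.comap (fun (ω : EuclideanSpace ℝ ι) (x : cell p) => ω x) inferInstance] (g p))
    (hreg : ∀ p ω, ‖g p ω‖ ≤ ε * exp (κ * (∑ x ∈ cell p, ω x ^ 2) / 2))
    (hsmall : Real.exp 1 * (ε * ((1 - θ) ^ (-(κ * γ / (2 * θ)))) ^ v) * ((Δ : ℝ) + 1) ^ 2 ≤ 1 / 2) (C : Finset V) :
    Complex.exp (pertLogZ (multivariateGaussian 0 Γ) g R C) = pertZ (multivariateGaussian 0 Γ) g C := by
  obtain ⟨hle, hindep, hm, hint, hact, hε'⟩ :=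
    regulated_hypotheses hΓ hΓop hdiag hγ hfr cell hdisj hv hR hε hκ hθ0 hθ1 hκθ hmeas hreg
  exact act_exp_pertLogZ hΔ hnbr hle hindep hm hint hact hε' hsmall C

/-- **THE END — `log Z` OF REGULATED FACTORS OVER A FINITE-RANGE GAUSSIAN FIELD IS EXTENSIVE WITH AN `O(εA^v)` DENSITY, UNIFORMLY IN THE
VOLUME**: `‖log Z(C)‖ ≤ #C·(Δ+1)·2e·(εA^v)`, `A = (1−θ)^{−κγ∕(2θ)}`, for every finite cell set `C`, under `e·(εA^v)·(Δ+1)² ≤ 1∕2` — with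
NO sup bound on the factors and NO volume-dependent prefactor. [folklore] -/
theorem regulated_norm_pertLogZ_le [DecidableEq V] {Γ : Matrix ι ι ℝ} {γop γ : ℝ} (hΓ : Γ.PosSemidef)
    (hΓop : (γop • (1 : Matrix ι ι ℝ) - Γ).PosSemidef) (hdiag : ∀ i, Γ i i ≤ γ) (hγ : 0 ≤ γ) (cell : V → Finset ι)
    (hdisj : ∀ p q, p ≠ q → Disjoint (cell p) (cell q)) {v : ℕ} (hv : ∀ p, (cell p).card ≤ v) {R : V → V → Prop} [DecidableRel R]
    (hRsymm : ∀ x y, R x y → R y x) {nbr : V → Finset V} {Δ : ℕ} (hΔ : ∀ x, (nbr x).card ≤ Δ) (hnbr : ∀ x y, R x y → y ∈ nbr x)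
    {g : V → EuclideanSpace ℝ ι → ℂ} {ε κ θ : ℝ} (hε : 0 ≤ ε) (hκ : 0 ≤ κ) (hθ0 : 0 < θ) (hθ1 : θ < 1) (hκθ : κ * γop ≤ θ)
    (hreg : ∀ p ω, ‖g p ω‖ ≤ ε * exp (κ * (∑ x ∈ cell p, ω x ^ 2) / 2))
    (hsmall : Real.exp 1 * (ε * ((1 - θ) ^ (-(κ * γ / (2 * θ)))) ^ v) * ((Δ : ℝ) + 1) ^ 2 ≤ 1 / 2) (C : Finset V) :
    ‖pertLogZ (multivariateGaussian 0 Γ) g R C‖ ≤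
      C.card * ((Δ : ℝ) + 1) * (2 * (Real.exp 1 * (ε * ((1 - θ) ^ (-(κ * γ / (2 * θ)))) ^ v))) :=
  act_norm_pertLogZ_le hRsymm hΔ hnbr
    (fun K _ => norm_cellActivity_le_of_regulated hΓ hΓop hdiag hγ cell hdisj hv hε hκ hθ0 hθ1 hκθ hreg K)
    (mul_nonneg hε (pow_nonneg (zero_le_one.trans (one_le_regulatorCost (mul_nonneg hκ hγ) hθ0 hθ1)) _)) hsmall C

/-! ## §5. Toy -/

/-- Toy (§1 with one cell): a single regulated factor is regulated on its own cell. -/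
example (cell : Unit → Finset (Fin 2)) (g : Unit → EuclideanSpace ℝ (Fin 2) → ℂ) (ε κ : ℝ)
    (hreg : ∀ p ω, ‖g p ω‖ ≤ ε * exp (κ * (∑ x ∈ cell p, ω x ^ 2) / 2)) (ω : EuclideanSpace ℝ (Fin 2)) :
    ‖∏ p ∈ ({()} : Finset Unit), g p ω‖ ≤ ε ^ ({()} : Finset Unit).card * exp (κ * (∑ x ∈ ({()} : Finset Unit).biUnion cell, ω x ^ 2) / 2) :=
  norm_prod_le_regulator cell (fun p q hpq => absurd (Subsingleton.elim p q) hpq) hreg {()} ω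

end Summit.QuantumFields.BalabanUV.T4Continuum.NE7b.SupRegulatedActivityBound
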